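import Literature.NumberTheory.Automorphic.ShimuraCurveRibetTakahashiNumeratorProofs
import Literature.NumberTheory.Automorphic.ShimuraCurveDataExistence
import Literature.NumberTheory.EllipticCurves.PastenHeightBoundsLemma68LocalProofs
import Literature.NumberTheory.EllipticCurves.MultiplicativeComponentGroupOrder
import HarnessLib

/-!
# Pasten 2024, Thm. 6.1 (numerator of `γ_{D,M,E}`): assembly of the printed proof over the tree's
# facts — Lemma 6.8 and the Shimura curves discharged, the open content isolated

Topic `NumberTheory/Automorphic`; a proofs-only companion (theorems only: no definition, no named
fact, nothing restated; D-0026) of `ShimuraCurveRibetTakahashi.lean`, for its named fact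
`Literature.NumberTheory.Automorphic.PastenShimura2024_thm_6_1` (H. Pasten, *Shimura curves and
the abc conjecture*, J. Number Theory 254 (2024) = arXiv:1705.09251, Thm. 6.1 p. 20: for `E/ℚ` of
conductor `N` and an admissible factorisation `N = DM`, the numerator of `γ_{D,M,E}` —
`δ_{1,N}/δ_{D,M} = γ_{D,M,E} · ∏_{p ∣ D} v_p(Δ_E)`, display (6.1) — is supported on primes `≤ 163`
and is at most `163^{ω(D)}`), continuing `ShimuraCurveRibetTakahashiNumeratorProofs.lean`.

That file performs the whole printed proof of §6.9 (p. 25: (EqSequentially) from Prop. 6.13 and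
Lemma 6.8, then the telescoping over `D = p₁r₁⋯pₙrₙ`) and leaves
`PastenShimura2024_thm_6_1_of_prop_6_13_of_lemma_6_8 : hX → hP → h0 → h613 → h68 → Thm. 6.1`
with five inputs. Two of them have meanwhile become available in the tree and are discharged
here, so that what remains is stated over declarations of the tree only where such exist:

* `hX` (Shimura curve data at the intermediate levels `(d, prM)`) is the tree's THEOREM
  `nonempty_shimuraCurveData_holds` (`ShimuraCurveDataExistence.lean`, Vignéras LNM 800);
* `h68` (Lemma 6.8 p. 22, in the idiom `v_p(Δ_{W'}) · b = a · v_p(Δ_W)`, `1 ≤ a, b ≤ 163`, for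
  `W ∼ W'` and `p ∥ N_W`) follows from the tree's NAMED FACT
  `Literature.NumberTheory.EllipticCurves.ModularForms.PastenShimura2024_lemma_6_8`
  (`PastenHeightBounds.lean`; stated with places `v` of `ℤ`, `HasMultiplicativeReductionAt` and
  `ordMinimalDiscriminant`) — `lemma_6_8_factorization_form`: `p ∥ N_W` gives `f_p = 1`
  (`factorization_conductorNorm_holds`), i.e. multiplicative reduction at `v_p`
  (`conductorExponent_eq_one_iff_holds`, Silverman ATAEC IV.10.2(b)), and
  `ord_{v_p} Δ_min = v_p(|Δ_min|)` (`factorization_minimalDiscriminantNorm_holds`); and that named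
  fact is itself reduced in the tree to Mazur–Kenku alone
  (`PastenShimura2024_lemma_6_8_of_mazurKenku'`, `PastenHeightBoundsLemma68LocalProofs.lean`: the
  local input at a multiplicative prime via the modular equation of prime level).

What is proved (sorry-free):

* `lemma_6_8_factorization_form` — `PastenShimura2024_lemma_6_8 → h68`;
* `PastenShimura2024_thm_6_1_of_prop_6_13_of_lemma_6_8_fact` — Thm. 6.1 (numerator) from the
  named facts `nonempty_shimuraParametrizationData` (Jacquet–Langlands, Pasten §2 p. 12) and
  `PastenShimura2024_lemma_6_8`, and the two inputs that are not declarations of the tree: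
  `h0` (the case `D = 1`: `J₀^1(N) = J₀(N)`, §2 p. 12 — the tree renders `δ_{1,N}` once through
  classical data `ModularParametrizationData` and once through Shimura data on a
  `ShimuraCurveData 1 N`, and the fact asserts at `D = 1` exactly that the former divides the
  latter; `dvd_deg_of_PastenShimura2024_thm_6_1` shows the fact gives `h0` back) and `h613`
  (Prop. 6.13 p. 23 = Ribet–Takahashi 1997 Thm. 2, `δ_{d,prM}/δ_{dpr,M} = c_p(A_{d,prM})
  c_r(A_{dpr,M}) / (i_p² j_r²)`: Néron models and component groups of `J₀^D(M)`,
  Deligne–Rapoport and Čerednik–Drinfeld, Ribet's exact sequence — no vocabulary in the tree);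
* `PastenShimura2024_thm_6_1_of_prop_6_13_of_mazurKenku` — the same with Lemma 6.8 replaced by
  its only remaining input, the named fact
  `Literature.NumberTheory.EllipticCurves.mazurKenku_exists_cyclic_isogeny` (Mazur 1978 Thm. 1,
  Kenku 1982; Silverman AEC IX.6 Ex. 6.4).

So `PastenShimura2024_thm_6_1_holds` is
`PastenShimura2024_thm_6_1_of_prop_6_13_of_mazurKenku mazurKenku_exists_cyclic_isogeny_holds
nonempty_shimuraParametrizationData_holds h0 h613` once Mazur–Kenku and the Jacquet–Langlands
existence are theorems of the tree and `h0`, `h613` are available; nothing else of the printed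
proof of the numerator statement is missing.

## References

* H. Pasten, *Shimura curves and the abc conjecture*, J. Number Theory 254 (2024) 214–335 =
  arXiv:1705.09251: §2 p. 12, Thm. 6.1 p. 20, §6.4 and Lemma 6.8 p. 22, §6.6 and Prop. 6.13
  p. 23, §6.9 p. 25. [PastenShimura2024]
* K. A. Ribet, S. Takahashi, *Parametrizations of elliptic curves by Shimura curves and by
  classical modular curves*, PNAS 94 (1997) 11110–11114, Thm. 2. [RibetTakahashi1997]
* B. Mazur, *Rational isogenies of prime degree*, Invent. Math. 44 (1978), Thm. 1 [Mazur1978];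
  M. A. Kenku, J. Number Theory 15 (1982) 199–202 [Kenku1982]; J. H. Silverman, *The Arithmetic
  of Elliptic Curves*, 2nd ed., IX.6 Ex. 6.4, VII.5.1 [SilvermanAEC2009]; J. H. Silverman,
  *Advanced Topics*, IV.10.2(b) [SilvermanATAEC1994].
-/

noncomputable section

open scoped MatrixGroups ModularForm

namespace Literature.NumberTheory.Automorphic

open IsDedekindDomain
open Literature.NumberTheory.EllipticCurves (natGenerator_primesEquiv_symm
  mazurKenku_exists_cyclic_isogeny)
open Literature.NumberTheory.EllipticCurves.ModularForms (ModularParametrizationData IsNewformOf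
  PastenShimura2024_lemma_6_8 PastenShimura2024_lemma_6_8_of_mazurKenku')

/-! ### Lemma 6.8 in the idiom of (EqSequentially) -/

/-- **Lemma 6.8 (p. 22), from the tree's named fact, in the idiom of the proof of Thm. 6.1.**
The fact `PastenShimura2024_lemma_6_8` speaks of a place `v` of `ℤ` of multiplicative reduction and
of `c_v = ord_v Δ_min`; the proof of Thm. 6.1 (§6.9 p. 25) applies it at the primes `p ∣ D`, which
divide the conductor `N = DM` exactly once (§2 p. 12: "the primes of multiplicative reduction"),
and with `c_p(E) = v_p(Δ_E)`, the exponent of `p` in the minimal discriminant. The translation: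
`p ∥ N_W` gives `f_p = v_p(N_W) = 1` (`N_W = ∏ p^{f_p}`, tree `factorization_conductorNorm_holds`),
hence multiplicative reduction at the place `v_p` (tree `conductorExponent_eq_one_iff_holds`,
Silverman ATAEC IV.10.2(b)), and `ord_{v_p} Δ_min = v_p(|Δ_min|)` for both curves (tree
`factorization_minimalDiscriminantNorm_holds`). The conclusion is literally the hypothesis `h68` of
`eqSequentially_of_prop_6_13_of_lemma_6_8`.
[cite: PastenShimura2024, Lemma 6.8 p. 22, with §6.4 (c_p(A) = v_p(Δ_A)) and §6.9 p. 25] -/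
theorem lemma_6_8_factorization_form (h68 : PastenShimura2024_lemma_6_8)
    (W W' : WeierstrassCurve ℚ) [W.IsElliptic] [W'.IsElliptic] (hiso : W.IsIsogenous W')
    (p : ℕ) (hp : p.Prime) (hpN : p ∣ W.conductorNorm ℤ) (hp2 : ¬ p ^ 2 ∣ W.conductorNorm ℤ) :
    ∃ a b : ℕ, 0 < a ∧ a ≤ 163 ∧ 0 < b ∧ b ≤ 163 ∧
      (W'.minimalDiscriminantNorm ℤ).factorization p * b =
        a * (W.minimalDiscriminantNorm ℤ).factorization p := by
  set v : HeightOneSpectrum ℤ := (Rat.HeightOneSpectrum.primesEquiv (R := ℤ)).symm ⟨p, hp⟩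
    with hv
  have hgen : Rat.HeightOneSpectrum.natGenerator v = p := natGenerator_primesEquiv_symm hp
  -- `p ∥ N_W`: the conductor exponent at `v` is `1`
  have hN0 : W.conductorNorm ℤ ≠ 0 := fun h0 => hp2 (h0 ▸ dvd_zero _)
  have hfac : (W.conductorNorm ℤ).factorization p = 1 := by
    have h1 : 0 < (W.conductorNorm ℤ).factorization p := hp.factorization_pos_of_dvd hN0 hpN
    have h2 : ¬ 2 ≤ (W.conductorNorm ℤ).factorization p := fun h =>
      hp2 ((hp.pow_dvd_iff_le_factorization hN0).mpr h)
    omega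
  have hf : W.conductorExponent v = 1 := by
    have h := W.factorization_conductorNorm_holds v
    rw [hgen] at h
    rw [← h, hfac]
  -- hence multiplicative reduction at `v`, and Lemma 6.8 applies
  have hmult : W.HasMultiplicativeReductionAt v :=
    (WeierstrassCurve.conductorExponent_eq_one_iff_holds v W).mp hf
  obtain ⟨m, n, hm, hm163, hn, hn163, hmn⟩ := h68 W W' hiso v hmult
  -- `ord_v Δ_min = v_p(|Δ_min|)` for `W` and `W'`
  have hΔ : (W.minimalDiscriminantNorm ℤ).factorization p = W.ordMinimalDiscriminant v := by
    have h := W.factorization_minimalDiscriminantNorm_holds v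
    rwa [hgen] at h
  have hΔ' : (W'.minimalDiscriminantNorm ℤ).factorization p = W'.ordMinimalDiscriminant v := by
    have h := W'.factorization_minimalDiscriminantNorm_holds v
    rwa [hgen] at h
  refine ⟨n, m, hn, hn163, hm, hm163, ?_⟩
  rw [hΔ, hΔ', ← hmn, mul_comm]

/-! ### Thm. 6.1 (numerator) over the tree's facts -/

/-- **Pasten 2024, Thm. 6.1 (numerator of `γ_{D,M,E}`) from Prop. 6.13, with Lemma 6.8 and the
Shimura curves taken from the tree.** The printed proof (§6.9 p. 25: (EqSequentially) from
Prop. 6.13 and Lemma 6.8, then the telescoping — `PastenShimura2024_thm_6_1_of_prop_6_13_of_lemma_6_8`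
of `ShimuraCurveRibetTakahashiNumeratorProofs.lean`) with: the intermediate curves `X₀^d(prM)`
from the THEOREM `nonempty_shimuraCurveData_holds`; Lemma 6.8 from the named fact
`PastenShimura2024_lemma_6_8` (`lemma_6_8_factorization_form`); the Jacquet–Langlands data at the
intermediate levels from the named fact `nonempty_shimuraParametrizationData` (§2 p. 12); and the
two inputs without a declaration in the tree kept as hypotheses — `h0`, the case `D = 1`
(`J₀^1(N) = J₀(N)`, §2 p. 12: the class-minimal classical degree divides the class-minimal degree
of Shimura data on a `ShimuraCurveData 1 N`; equivalent to the fact at `D = 1`,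
`dvd_deg_of_PastenShimura2024_thm_6_1`), and `h613`, Prop. 6.13 p. 23 (= Ribet–Takahashi 1997
Thm. 2) in the tree's minimal-degree idiom with `i_p, j_r ≥ 1` existential and
`c_p(A) = v_p(Δ_A)` (§6.4) of the curves of the class-minimal data.
[cite: PastenShimura2024, Thm. 6.1 p. 20, proof §6.9 p. 25, Prop. 6.13 p. 23, Lemma 6.8 p. 22, §2 p. 12] -/
theorem PastenShimura2024_thm_6_1_of_prop_6_13_of_lemma_6_8_fact
    (h68 : PastenShimura2024_lemma_6_8) (hP : nonempty_shimuraParametrizationData)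
    (h0 : ∀ {N : ℕ} [NeZero N] (X : ShimuraCurveData 1 N) (W : WeierstrassCurve ℚ) [W.IsElliptic]
      [W.IsGloballyMinimal], W.conductorNorm ℤ = N →
      ∀ (W₁ : WeierstrassCurve ℚ) [W₁.IsElliptic] (D₁ : ModularParametrizationData W₁ N),
        IsNewformOf W D₁.f →
        (∀ (W₂ : WeierstrassCurve ℚ) [W₂.IsElliptic] (D₂ : ModularParametrizationData W₂ N),
            D₂.f = D₁.f → D₁.modularDegree ≤ D₂.modularDegree) →
      ∀ (W' : WeierstrassCurve ℚ) [W'.IsElliptic] (P : ShimuraParametrizationData X W'),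
        P.IsMinimalFor W → D₁.modularDegree ∣ P.deg)
    (h613 : ∀ {N D M d p r : ℕ}, p.Prime → r.Prime → p ≠ r → D = d * (p * r) →
      IsAdmissibleFactorization N D M →
      ∀ (X₁ : ShimuraCurveData d (p * r * M)) (X₂ : ShimuraCurveData D M)
        (W : WeierstrassCurve ℚ) [W.IsElliptic] [W.IsGloballyMinimal], W.conductorNorm ℤ = N →
      ∀ (W₁' : WeierstrassCurve ℚ) [W₁'.IsElliptic] (P₁ : ShimuraParametrizationData X₁ W₁'),
        P₁.IsMinimalFor W →
      ∀ (W₂' : WeierstrassCurve ℚ) [W₂'.IsElliptic] (P₂ : ShimuraParametrizationData X₂ W₂'),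
        P₂.IsMinimalFor W →
        ∃ i j : ℕ, 0 < i ∧ 0 < j ∧
          P₁.deg * (i ^ 2 * j ^ 2) = P₂.deg *
            ((W₁'.minimalDiscriminantNorm ℤ).factorization p *
              (W₂'.minimalDiscriminantNorm ℤ).factorization r)) :
    PastenShimura2024_thm_6_1 :=
  PastenShimura2024_thm_6_1_of_prop_6_13_of_lemma_6_8 nonempty_shimuraCurveData_holds hP h0 h613
    fun W W' _ _ hiso p hp hpN hp2 => lemma_6_8_factorization_form h68 W W' hiso p hp hpN hp2

/-- **Pasten 2024, Thm. 6.1 (numerator of `γ_{D,M,E}`) from Prop. 6.13 and Mazur–Kenku.** As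
`PastenShimura2024_thm_6_1_of_prop_6_13_of_lemma_6_8_fact`, with Lemma 6.8 replaced by the only
input of its printed proof that is not a theorem of the tree, the named fact
`mazurKenku_exists_cyclic_isogeny` (p. 22: "by results of Mazur and Kenku we know that
`n := deg(α) ≤ 163`"; the rest of that proof is the tree's
`PastenShimura2024_lemma_6_8_of_mazurKenku'`). Hence the discharge of the fact waits exactly for:
Mazur–Kenku, the Jacquet–Langlands existence `nonempty_shimuraParametrizationData`, the `D = 1`
bridge `h0` and Prop. 6.13 `h613`.
[cite: PastenShimura2024, Thm. 6.1 p. 20, proof §6.9 p. 25, Prop. 6.13 p. 23, Lemma 6.8 p. 22 (proof)] [cite: Mazur1978, Thm. 1] [cite: Kenku1982] -/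
theorem PastenShimura2024_thm_6_1_of_prop_6_13_of_mazurKenku
    (hMK : mazurKenku_exists_cyclic_isogeny) (hP : nonempty_shimuraParametrizationData)
    (h0 : ∀ {N : ℕ} [NeZero N] (X : ShimuraCurveData 1 N) (W : WeierstrassCurve ℚ) [W.IsElliptic]
      [W.IsGloballyMinimal], W.conductorNorm ℤ = N →
      ∀ (W₁ : WeierstrassCurve ℚ) [W₁.IsElliptic] (D₁ : ModularParametrizationData W₁ N),
        IsNewformOf W D₁.f →
        (∀ (W₂ : WeierstrassCurve ℚ) [W₂.IsElliptic] (D₂ : ModularParametrizationData W₂ N),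
            D₂.f = D₁.f → D₁.modularDegree ≤ D₂.modularDegree) →
      ∀ (W' : WeierstrassCurve ℚ) [W'.IsElliptic] (P : ShimuraParametrizationData X W'),
        P.IsMinimalFor W → D₁.modularDegree ∣ P.deg)
    (h613 : ∀ {N D M d p r : ℕ}, p.Prime → r.Prime → p ≠ r → D = d * (p * r) →
      IsAdmissibleFactorization N D M →
      ∀ (X₁ : ShimuraCurveData d (p * r * M)) (X₂ : ShimuraCurveData D M)
        (W : WeierstrassCurve ℚ) [W.IsElliptic] [W.IsGloballyMinimal], W.conductorNorm ℤ = N →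
      ∀ (W₁' : WeierstrassCurve ℚ) [W₁'.IsElliptic] (P₁ : ShimuraParametrizationData X₁ W₁'),
        P₁.IsMinimalFor W →
      ∀ (W₂' : WeierstrassCurve ℚ) [W₂'.IsElliptic] (P₂ : ShimuraParametrizationData X₂ W₂'),
        P₂.IsMinimalFor W →
        ∃ i j : ℕ, 0 < i ∧ 0 < j ∧
          P₁.deg * (i ^ 2 * j ^ 2) = P₂.deg *
            ((W₁'.minimalDiscriminantNorm ℤ).factorization p *
              (W₂'.minimalDiscriminantNorm ℤ).factorization r)) :
    PastenShimura2024_thm_6_1 :=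
  PastenShimura2024_thm_6_1_of_prop_6_13_of_lemma_6_8_fact
    (PastenShimura2024_lemma_6_8_of_mazurKenku' hMK) hP h0 h613

end Literature.NumberTheory.Automorphic

end
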